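import Summits.BirchSwinnertonDyer.BirchSwinnertonDyer.Theses.BiquadraticEisensteinDescent
import Summits.BirchSwinnertonDyer.BirchSwinnertonDyer.Theorems.TeichmullerTwistDescentCells57FromKato
import Summits.BirchSwinnertonDyer.Rank1Residual.WAll.AltClosersManinCells
import Summits.BirchSwinnertonDyer.Rank1Residual.Additive.AdditiveTorsionFiveSeven
import Literature.AlgebraicGeometry.PlaneCurves.HessePencilHarmonicMembers
import Literature.NumberTheory.EllipticCurves.ComplexMultiplicationNotSemistable
import HarnessLib

set_option linter.dupNamespace false -- `Summit.BirchSwinnertonDyer.BirchSwinnertonDyer.Theorems.…` (summit = sub)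
set_option autoImplicit false

/-!
# Crux `ManinDatumSupercuspidalCMInert` (stmt-BirchSwinnertonDyer-20111, BED r605) and its registered stubs
# `stub_S5` / `stub_S7`, GRANTED ONE printed-input fact: Kato's zeta elements in Néron units
# (`kato_neron_isIntegral_twistedSymbolSum_of_additive_five_le`) — the CM cells never meet the
# Kosters–Pannekoek sub-residue

Route `BiquadraticEisensteinDescent` (cell `pub/bsd-wall`, width-prover seat `bsd-wall-cm-bed-w1` g0, D-0152 M1).
Companion of `BiquadraticEisensteinDescentManinDatumSupercuspidalCMInertOfSCMU.lean` (the same crux from the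
TTD crux SCMU57). THIS file removes the research crux from the reduction: the Teichmüller-twist-descent line
(`Theorems/TeichmullerTwistDescentCells57FromKato.lean`, seat `bsd-line-ttd-p2`, resting on seat
`bsd-wall-manin-p1`'s tame-twist lever `ManinFrameResidueProperRTameTwist.not_dvd_c_of_tameTwist57`) proves

  `TeichmullerTwistDescent.cell57_of_kato57_of_noPTorsion` : GRANTED Kato's fact F″, for `W/ℚ` globally
  minimal with a lattice-optimal datum `D` at its conductor level, additive at `p ∈ {5, 7}` with `E[p]`
  irreducible and NO `ℚ_p`-rational point of order `p`: `p ∤ c(D)`;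

and the tree locates the `ℚ_p`-rational `p`-torsion at an additive `p ≥ 5` on `v₅(c₄) = 1` / `v₇(c₆) = 1`
(`Additive.eq_zero_of_prime_nsmul_eq_zero_of_addv`, Mazur 1977 III §5 Step 1 / Kosters–Pannekoek). On the
BED cells this exceptional locus is EMPTY for a trivial reason: `j = 0 ⟺ c₄ = 0` (Mathlib
`WeierstrassCurve.j_eq_zero_iff`) and `j = 1728 ⟺ c₆ = 0` (`PlaneCurves.j_eq_1728_iff_c₆_eq_zero`), so
`v₅(c₄) = v₅(0) = 0 ≠ 1` at (`p = 5`, `j = 0`) and `v₇(c₆) = 0 ≠ 1` at (`p = 7`, `j = 1728`). Hence, with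
additivity (`not_mult_of_hasCM`) and irreducibility (`X12.irr_of_cmInert`) as in the companion file:

* `noPTorsion_padic_five_of_j_eq_zero` — `W(ℚ₅)[5] = 0` for `W` globally minimal, additive at `5`, `j = 0`;
* `noPTorsion_padic_seven_of_j_eq_1728` — `W(ℚ₇)[7] = 0` for `W` globally minimal, additive at `7`, `j = 1728`;
* `stub_S5_of_kato`, `stub_S7_of_kato` — the registered stub signatures VERBATIM behind the ONE hypothesis
  `hK : kato_neron_isIntegral_twistedSymbolSum_of_additive_five_le` (the Kodaira-type and analytic-rank
  binders are idle: no `Iₙ*`-freeness and no rank input is used);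
* `maninDatumSupercuspidalCMInert_of_kato` — the ROUTE DECL `ManinDatumSupercuspidalCMInert` BY NAME behind `hK`.

HONEST STATUS. `kato_neron_isIntegral_twistedSymbolSum_of_additive_five_le` is an UNPROVED named fact
(`Literature/NumberTheory/EllipticCurves/KatoAdditiveTwistedValueNeronIntegrality.lean`: a derived reading,
weaker than print, of Kato Astérisque 295 (8.1.3)/Thm. 9.7/Thm. 6.6 + Kim–Nakamura Cor. 2.4 +
Kosters–Pannekoek Thm. 1, referee flag recorded there; size XL, no `_holds`). So this file makes
stmt-BirchSwinnertonDyer-20111 CLOSED MODULO THAT ONE PRINTED INPUT — the same footing as the TTD/EF57 cells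
"from Kato" — and, unlike the general supercuspidal cell SCMU57, WITHOUT the LOW Kosters–Pannekoek crux
(stmt-BirchSwinnertonDyer-23884): the CM `j ∈ {0, 1728}` cells carry no local `p`-torsion. It does NOT close
the item unconditionally (that needs F″ proved, or the pen threading a by-name binder for F″ in front of the
crux). THEOREMS ONLY (no definition, no named fact, no `sorry`). BSD is not proved by any of this.

References: [Kato2004Asterisque] (8.1.3), Thm. 9.7, Thm. 6.6 (1); [KimNakamura2020] Cor. 2.4;
[KostersPannekoek2017] Thm. 1, Cor. 2; [Mazur1977] Ch. III §5 Step 1; [Mazur1978] Prop. 6.3;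
[SilvermanATAEC1994] Thm. II.6.4; [SilvermanAEC2009] III §1 Prop. 1.4.
-/

noncomputable section

open scoped Classical

open WeierstrassCurve IsDedekindDomain NumberField
  Literature.NumberTheory.EllipticCurves Literature.NumberTheory.EllipticCurves.ModularForms
  Literature.NumberTheory.EllipticCurves.Rank1Residual
  Literature.NumberTheory.DiophantineGeometry
  Literature.AlgebraicGeometry.PlaneCurves
  Summit.BirchSwinnertonDyer.Rank1Residual.Additive
  Summit.BirchSwinnertonDyer.Rank1Residual.X12
  Summit.BirchSwinnertonDyer.BirchSwinnertonDyer.Theorems.TeichmullerTwistDescent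

namespace Summit.BirchSwinnertonDyer.BirchSwinnertonDyer.Theorems.BiquadraticEisensteinDescentManinDatumSupercuspidalCMInertOfKato

open Summit.BirchSwinnertonDyer.BirchSwinnertonDyer.Theses.BiquadraticEisensteinDescent

/-! ## §1 No local `p`-torsion on the CM cells `j = 0` @ 5 and `j = 1728` @ 7 -/

/-- **`W(ℚ₅)[5] = 0` for a globally minimal `W/ℚ` with additive reduction at `5` and `j(W) = 0`.** A
`ℚ₅`-rational point of order `5` at an additive `5` forces `v₅(c₄) = 1` (Mazur 1977 III §5 Step 1, tree
`Additive.eq_zero_of_prime_nsmul_eq_zero_of_addv`), but `j = 0` means `c₄ = 0`, `v₅(c₄) = 0`.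
[cite: Mazur1977, Ch. III §5, Step 1, p. 158] [cite: KostersPannekoek2017, Cor. 2] -/
theorem noPTorsion_padic_five_of_j_eq_zero (W : WeierstrassCurve ℚ) [W.IsElliptic] [W.IsGloballyMinimal]
    {p : ℕ} [Fact p.Prime] (hp5 : p = 5) (hadd : Addv W p) (hj : W.j = 0) :
    ∀ P : (W.baseChange ℚ_[p]).toAffine.Point, p • P = 0 → P = 0 := by
  intro P hP
  have hc₄ : W.c₄ = 0 := (WeierstrassCurve.j_eq_zero_iff (W := W)).mp hj
  exact eq_zero_of_prime_nsmul_eq_zero_of_addv W p (by omega) hadd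
    (fun _ h1 ↦ by rw [hc₄, padicValRat.zero] at h1; exact zero_ne_one h1) (fun h7 ↦ by omega) hP

/-- **`W(ℚ₇)[7] = 0` for a globally minimal `W/ℚ` with additive reduction at `7` and `j(W) = 1728`.** A
`ℚ₇`-rational point of order `7` at an additive `7` forces `v₇(c₆) = 1` (Mazur 1977 III §5 Step 1), but
`j = 1728` means `c₆ = 0`, `v₇(c₆) = 0`.
[cite: Mazur1977, Ch. III §5, Step 1, p. 158] [cite: KostersPannekoek2017, Cor. 2]
[cite: SilvermanAEC2009, III §1, proof of Prop. 1.4 (b), Case 2] -/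
theorem noPTorsion_padic_seven_of_j_eq_1728 (W : WeierstrassCurve ℚ) [W.IsElliptic] [W.IsGloballyMinimal]
    {p : ℕ} [Fact p.Prime] (hp7 : p = 7) (hadd : Addv W p) (hj : W.j = 1728) :
    ∀ P : (W.baseChange ℚ_[p]).toAffine.Point, p • P = 0 → P = 0 := by
  intro P hP
  have hc₆ : W.c₆ = 0 := (j_eq_1728_iff_c₆_eq_zero W).mp hj
  exact eq_zero_of_prime_nsmul_eq_zero_of_addv W p (by omega) hadd (fun h5 ↦ by omega)
    (fun _ h1 ↦ by rw [hc₆, padicValRat.zero] at h1; exact zero_ne_one h1) hP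

/-! ## §2 The CM-inert cells from Kato's fact alone -/

/-- **GRANTED Kato's fact F″, `p ∤ c(D)` on the whole CM-inert additive corner at `p ∈ {5,7}` off local
`p`-torsion** — for `W/ℚ` globally minimal with CM, `p ∈ {5, 7}` inert in the CM field and bad, NO
`ℚ_p`-rational point of order `p`, and a lattice-optimal datum `D` at the conductor level: the TTD cell
theorem `cell57_of_kato57_of_noPTorsion` with additivity (`not_mult_of_hasCM`) and irreducibility
(`irr_of_cmInert`) supplied. [cite: Kato2004Asterisque, Thm. 9.7 (p. 189)] [cite: SilvermanATAEC1994, Thm. II.6.4]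
[cite: Mazur1978, §6 Prop. 6.3 (1)] -/
theorem not_dvd_c_of_kato_of_hasCM_of_cmInert_of_noPTorsion
    (hK : kato_neron_isIntegral_twistedSymbolSum_of_additive_five_le)
    (W : WeierstrassCurve ℚ) [W.IsElliptic] [W.IsGloballyMinimal] (p : ℕ) [Fact p.Prime]
    [NeZero (W.conductorNorm ℤ)] (D : ModularParametrizationData W (W.conductorNorm ℤ))
    (hp57 : p = 5 ∨ p = 7) (hCM : W.HasCM) (hin : CMInert W p) (hbad : ¬ Good W p)
    (hPT : ∀ P : (W.baseChange ℚ_[p]).toAffine.Point, p • P = 0 → P = 0)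
    (hopt : ∀ z ∈ D.L.lattice, ∃ w ∈ periodLattice D.f, z = D.c * w) :
    ¬ (p : ℤ) ∣ D.c := by
  have hp2 : p ≠ 2 := by omega
  have hadd : Addv W p := ⟨hbad, not_mult_of_hasCM W hCM p⟩
  have hirr : Irr W p := irr_of_cmInert W p hp2 hin
  exact cell57_of_kato57_of_noPTorsion hK W p D hp57 hadd hirr hPT hopt

/-- **Stub `stub_S5` of skeleton `9438078f…` (crux `ManinDatumSupercuspidalCMInert`, BED r605), GRANTED Kato's
fact F″** — the registered signature verbatim: for `W/ℚ` globally minimal CM of analytic rank one, `p = 5`,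
`j(W) = 0`, `5` inert in the CM field and bad, `D` a lattice-optimal `X₀(N_W)`-datum and the place `v` over
`5` of type II/IV/IV*/II*: `5 ∤ c(D)`. The rank and Kodaira binders are idle (`W(ℚ₅)[5] = 0` from `j = 0`).
[cite: Kato2004Asterisque, Thm. 9.7 (p. 189)] [cite: Mazur1977, Ch. III §5, Step 1, p. 158] -/
theorem stub_S5_of_kato (hK : kato_neron_isIntegral_twistedSymbolSum_of_additive_five_le) :
    ∀ (W : WeierstrassCurve ℚ) [W.IsElliptic] [W.IsGloballyMinimal] [NeZero (W.conductorNorm ℤ)] (p : ℕ)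
      [Fact p.Prime] (D : ModularParametrizationData W (W.conductorNorm ℤ)) (v : IsDedekindDomain.HeightOneSpectrum ℤ),
      Rat.HeightOneSpectrum.natGenerator v = p → W.HasCM → W.analyticRank = 1 → p = 5 → W.j = 0 →
      CMInert W p → ¬ Good W p → (∀ z ∈ D.L.lattice, ∃ w ∈ periodLattice D.f, z = D.c * w) →
      (W.kodairaSymbolAt v = .II ∨ W.kodairaSymbolAt v = .IV ∨ W.kodairaSymbolAt v = .IVstar ∨
        W.kodairaSymbolAt v = .IIstar) → ¬ (p : ℤ) ∣ D.c := by
  intro W _ _ _ p _ D v _hv hCM _hr hp5 hj hin hbad hopt _hk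
  have hadd : Addv W p := ⟨hbad, not_mult_of_hasCM W hCM p⟩
  exact not_dvd_c_of_kato_of_hasCM_of_cmInert_of_noPTorsion hK W p D (Or.inl hp5) hCM hin hbad
    (noPTorsion_padic_five_of_j_eq_zero W hp5 hadd hj) hopt

/-- **Stub `stub_S7` of skeleton `9438078f…` (crux `ManinDatumSupercuspidalCMInert`, BED r605), GRANTED Kato's
fact F″** — the registered signature verbatim: for `W/ℚ` globally minimal CM of analytic rank one, `p = 7`,
`j(W) = 1728`, `7` inert in the CM field and bad, `D` a lattice-optimal `X₀(N_W)`-datum and the place `v` over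
`7` of type III/III*: `7 ∤ c(D)`. The rank and Kodaira binders are idle (`W(ℚ₇)[7] = 0` from `j = 1728`).
[cite: Kato2004Asterisque, Thm. 9.7 (p. 189)] [cite: Mazur1977, Ch. III §5, Step 1, p. 158] -/
theorem stub_S7_of_kato (hK : kato_neron_isIntegral_twistedSymbolSum_of_additive_five_le) :
    ∀ (W : WeierstrassCurve ℚ) [W.IsElliptic] [W.IsGloballyMinimal] [NeZero (W.conductorNorm ℤ)] (p : ℕ)
      [Fact p.Prime] (D : ModularParametrizationData W (W.conductorNorm ℤ)) (v : IsDedekindDomain.HeightOneSpectrum ℤ),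
      Rat.HeightOneSpectrum.natGenerator v = p → W.HasCM → W.analyticRank = 1 → p = 7 → W.j = 1728 →
      CMInert W p → ¬ Good W p → (∀ z ∈ D.L.lattice, ∃ w ∈ periodLattice D.f, z = D.c * w) →
      (W.kodairaSymbolAt v = .III ∨ W.kodairaSymbolAt v = .IIIstar) → ¬ (p : ℤ) ∣ D.c := by
  intro W _ _ _ p _ D v _hv hCM _hr hp7 hj hin hbad hopt _hk
  have hadd : Addv W p := ⟨hbad, not_mult_of_hasCM W hCM p⟩
  exact not_dvd_c_of_kato_of_hasCM_of_cmInert_of_noPTorsion hK W p D (Or.inr hp7) hCM hin hbad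
    (noPTorsion_padic_seven_of_j_eq_1728 W hp7 hadd hj) hopt

/-- **The crux `ManinDatumSupercuspidalCMInert` (stmt-BirchSwinnertonDyer-20111) — THE ROUTE DECL BY NAME —
GRANTED ONE printed input, Kato's fact F″ `kato_neron_isIntegral_twistedSymbolSum_of_additive_five_le`**
(composition of the registered skeleton: the two cells are the two stubs). A CONDITIONAL closer: the item
closes when F″ is discharged or threaded by name in front of the crux; no research crux (in particular not
the LOW Kosters–Pannekoek cell stmt-BirchSwinnertonDyer-23884) remains on this path. BSD is not proved by
any of this. [cite: Kato2004Asterisque, (8.1.3) (p. 180), Thm. 9.7 (p. 189)] [cite: KimNakamura2020, Cor. 2.4]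
[cite: KostersPannekoek2017, Thm. 1 and Cor. 2] [cite: Mazur1977, Ch. III §5, Step 1, p. 158] -/
theorem maninDatumSupercuspidalCMInert_of_kato
    (hK : kato_neron_isIntegral_twistedSymbolSum_of_additive_five_le) :
    ManinDatumSupercuspidalCMInert := by
  intro W _ _ _ p _ D v hv hCM hr _hp57 hin hbad hopt hcell
  rcases hcell with ⟨hp5, hj, hk⟩ | ⟨hp7, hj, hk⟩
  · exact stub_S5_of_kato hK W p D v hv hCM hr hp5 hj hin hbad hopt hk
  · exact stub_S7_of_kato hK W p D v hv hCM hr hp7 hj hin hbad hopt hk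

/-! ## §3 The parent crux R₅₇ `ManinDatumFiveSevenCMInert` (stmt-BirchSwinnertonDyer-20242) from print
(appended 2026-08-28, same seat) -/

/-- **The PARENT crux `ManinDatumFiveSevenCMInert` (stmt-BirchSwinnertonDyer-20242, BED r6) — THE ROUTE DECL BY
NAME — GRANTED the route's four by-name published inputs `MazurManinOdd` (Mazur 1978 Cor. 4.1),
`AbbesUllmoManinGood` (Abbes–Ullmo 1996 Thm. A), `CesnaviciusManinTwo` (Česnavičius 2018),
`ModularityNewformExists`, AND Kato's fact F″.** The R57 split glue
(stmt-BirchSwinnertonDyer-20114 `ManinDatumFiveSevenCMInertOfParts`, closed by ty-2's route-independent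
`WAll.maninDatumFiveSevenCMInert_of_facts_of_supercuspidalResidual`: the `Iₙ*` cells by Mazur–Stevens in the
tree) fed with `maninDatumSupercuspidalCMInert_of_kato`. So the whole Manin datum of the
CM-inert corner at `p ∈ {5, 7}` is CLOSED MODULO PRINTED INPUTS (F″ being an unproved derived reading of
print); no research crux remains on this path. BSD is not proved by any of this.
[cite: Kato2004Asterisque, Thm. 9.7 (p. 189)] [cite: Mazur1978, Cor. 4.1] [cite: EdixhovenManin1991, Prop. 2] -/
theorem maninDatumFiveSevenCMInert_of_pub_of_kato (hM : MazurManinOdd) (hAU : AbbesUllmoManinGood)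
    (hC2 : CesnaviciusManinTwo) (hnf : ModularityNewformExists)
    (hK : kato_neron_isIntegral_twistedSymbolSum_of_additive_five_le) : ManinDatumFiveSevenCMInert :=
  -- the R57 split glue (stmt-20114) is ty-2's route-independent `WAll` reduction; cited, not re-proved
  Summit.BirchSwinnertonDyer.Rank1Residual.WAll.maninDatumFiveSevenCMInert_of_facts_of_supercuspidalResidual
    hM hAU hC2 hnf (maninDatumSupercuspidalCMInert_of_kato hK)

end Summit.BirchSwinnertonDyer.BirchSwinnertonDyer.Theorems.BiquadraticEisensteinDescentManinDatumSupercuspidalCMInertOfKato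

end
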